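import Mathlib
import Literature.NumberTheory.LFunctions.Zhang2022.AppendixAKappa2PrimePowers
import Literature.NumberTheory.LFunctions.Zhang2022.SkeletonPartThree
import HarnessLib

/-!
# Toolkit: sums of a multiplicative majorant over the integers having a prime factor below `D⁴`
# (`(m, 𝔮) > 1`, `𝔮 = ∏_{q<D⁴} q`) — the "drop the terms with `(m₁,𝔮) > 1`" mechanism of §17 p. 98

Topic `Literature/NumberTheory/LFunctions/Zhang2022` (Landau–Siegel audit tree; verdict-neutral).
Y. Zhang, *Discrete mean estimates and the Landau–Siegel zero*, arXiv:2211.02515v1 (2022)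
[Zhang2022LandauSiegel] — **an unrefereed manuscript under adjudication; nothing in this file asserts
or denies its Theorems 1–2, and no claim about Landau–Siegel zeros is made.** ZHANG-L discharge lane,
WP16 helper under the leaf `Typed.Section17.Eq17_9Rel` (§17.u021, χ-twisted reading RT16-int-1: the
remainder `R₂` of `Section17U021ChiDecomposition`, i.e. the terms with `(m₁,𝔮) > 1`).

§17 p. 98 (tex L4825): "we can drop the terms with … `(m₁,𝔮) > 1` with an acceptable error". The
mechanism (not in print): an `m₁` with `(m₁,𝔮) > 1` has a prime factor `p < D⁴`, and the coefficient
`κ̄₂(m₁)` then carries the small factor `|κ₂(p^k)| = |p^{−iβ₁} − 1| ≤ |b₁| log p` (`β₁ = ib₁`,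
`|b₁| ≍ α = π/𝓛⁹`). This file proves the ARITHMETIC of that mechanism, as theorems over the tree's
objects `MeanSquareMajorant.tau`, `MeanSquareMajorant.kappa₂`, `Skeleton.frakq`:

* `sum_div_filter_dvd_le_mul` — for a non-negative multiplicative `a` and a prime `p`:
  `Σ_{m≤N, p∣m} a(m)/m ≤ (Σ_{1≤k≤N} a(p^k)/p^k)·(Σ_{n≤N} a(n)/n)` (write `m = p^k·n′`, `p ∤ n′`);
* `sum_div_filter_exists_dvd_le` — for a finite set `S` of primes:
  `Σ_{m≤N, ∃p∈S, p∣m} a(m)/m ≤ (Σ_{p∈S}Σ_{1≤k≤N} a(p^k)/p^k)·(Σ_{n≤N} a(n)/n)`;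
* `exists_prime_lt_dvd_of_not_coprime_frakq` — `(m,𝔮) > 1 ⇒ ∃ p < D⁴` prime, `p ∣ m`;
* `sum_succ_mul_pow_le` — `Σ_{1≤k≤K} (k+1)x^k ≤ 6x` for `0 ≤ x ≤ 1/2`;
* `sum_tau_mul_norm_kappa₂_prime_pow_div_le` — `Σ_{1≤k≤K} τ₂(p^k)|κ₂(p^k)|/p^k ≤ 6|b₁|(log p)/p`;
* `sum_tau_mul_norm_kappa₂_div_le` — `Σ_{n≤N} τ₂(n)|κ₂(n)|/n ≤ majorantConst 0 2 · exp(2|b₁| log 4N)`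
  (Hall–Tenenbaum via the tree's `MeanSquareMajorant.sum_div_le`, `K = 2|b₁|`: `τ₂(p)|κ₂(p)| ≤ 2|b₁|log p`);
* `sum_not_coprime_frakq_tau_mul_norm_kappa₂_div_le` — THE BOUND:
  `Σ_{m≤N, (m,𝔮)>1} τ₂(m)|κ₂(m)|/m ≤ 6|b₁|(log D⁴ + log 4) · majorantConst 0 2 · exp(2|b₁| log 4N)`
  (Mertens `Σ_{p≤D⁴} log p/p ≤ log D⁴ + log 4`, tree `MertensBound.sum_log_div_prime_le`).

With `|b₁| ≍ 𝓛⁻⁹` and `N ≤ P` (`2|b₁| log 4N ≍ 2π`) the right side is `≍ 𝓛⁻⁸`. Theorems only; no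
definitions; standard axioms.

## References

* Y. Zhang, arXiv:2211.02515v1 (2022), §17 p. 98 (u021), tex L4825. [cite: Zhang2022LandauSiegel, §17 u021 p.98]
* R. R. Hall, G. Tenenbaum, *Divisors*, CUP 1988, (0.4). [cite: HallTenenbaum1988, (0.4)]
-/

noncomputable section

open Real Finset ArithmeticFunction

namespace Literature.NumberTheory.LFunctions.Zhang2022.MeanSquareMajorant

open Literature.NumberTheory.LFunctions.Zhang2022.Skeleton

/-! ## §1 Multiplicative majorants restricted to the multiples of a prime -/

section Generic

variable {a : ℕ → ℝ}

/-- **Multiples of a fixed prime.** For `a ≥ 0` multiplicative on coprime arguments and a prime `p`: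
`Σ_{1≤m≤N, p∣m} a(m)/m ≤ (Σ_{1≤k≤N} a(p^k)/p^k)·(Σ_{1≤n≤N} a(n)/n)` — write `m = p^k n′` with
`k = v_p(m) ≥ 1`, `p ∤ n′`; the map `m ↦ (k, n′)` is injective into `[1,N]×[1,N]` and
`a(m)/m = (a(p^k)/p^k)(a(n′)/n′)`. [cite: HallTenenbaum1988, (0.4)] -/
theorem sum_div_filter_dvd_le_mul (ha0 : ∀ n, 0 ≤ a n)
    (hmul : ∀ m n, Nat.Coprime m n → a (m * n) = a m * a n) {p : ℕ} (hp : p.Prime) (N : ℕ) :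
    ∑ m ∈ (Finset.Icc 1 N).filter (fun m => p ∣ m), a m / m ≤
      (∑ k ∈ Finset.Icc 1 N, a (p ^ k) / (p : ℝ) ^ k) * ∑ n ∈ Finset.Icc 1 N, a n / n := by
  classical
  set s := (Finset.Icc 1 N).filter (fun m => p ∣ m) with hs
  set e : ℕ → ℕ × ℕ := fun m => (m.factorization p, m / p ^ m.factorization p) with he
  set F : ℕ × ℕ → ℝ := fun x => a (p ^ x.1) / (p : ℝ) ^ x.1 * (a x.2 / x.2) with hF
  have hF0 : ∀ x, 0 ≤ F x := fun x => by
    simp only [hF]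
    exact mul_nonneg (div_nonneg (ha0 _) (by positivity)) (div_nonneg (ha0 _) (Nat.cast_nonneg _))
  -- termwise: `a(m)/m = F(e m)`
  have hterm : ∀ m ∈ s, a m / m = F (e m) := by
    intro m hm
    have hm0 : m ≠ 0 := by
      have := (Finset.mem_Icc.mp (Finset.mem_filter.mp hm).1).1; omega
    have hdecomp : p ^ m.factorization p * (m / p ^ m.factorization p) = m :=
      Nat.ordProj_mul_ordCompl_eq_self m p
    have hcop : Nat.Coprime (p ^ m.factorization p) (m / p ^ m.factorization p) :=
      (Nat.coprime_ordCompl hp hm0).pow_left _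
    simp only [hF, he]
    conv_lhs => rw [← hdecomp]
    rw [hmul _ _ hcop, Nat.cast_mul, Nat.cast_pow, mul_div_mul_comm]
  -- injectivity of `e` on `s`
  have hinj : Set.InjOn e s := by
    intro m _ m' _ h
    simp only [he, Prod.mk.injEq] at h
    rw [← Nat.ordProj_mul_ordCompl_eq_self m p, ← Nat.ordProj_mul_ordCompl_eq_self m' p, h.2, h.1]
  -- the image lies in the box `[1,N] × [1,N]`
  have himg : s.image e ⊆ Finset.Icc 1 N ×ˢ Finset.Icc 1 N := by
    intro x hx
    obtain ⟨m, hm, rfl⟩ := Finset.mem_image.mp hx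
    obtain ⟨hmI, hpm⟩ := Finset.mem_filter.mp hm
    obtain ⟨hm1, hmN⟩ := Finset.mem_Icc.mp hmI
    have hm0 : m ≠ 0 := by omega
    simp only [he, Finset.mem_product, Finset.mem_Icc]
    refine ⟨⟨hp.factorization_pos_of_dvd hm0 hpm, ?_⟩, ⟨Nat.ordCompl_pos p hm0, ?_⟩⟩
    · exact le_trans (Nat.factorization_lt p hm0).le hmN
    · exact le_trans (Nat.ordCompl_le m p) hmN
  calc ∑ m ∈ s, a m / m = ∑ m ∈ s, F (e m) := Finset.sum_congr rfl hterm
    _ = ∑ x ∈ s.image e, F x := (Finset.sum_image hinj).symm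
    _ ≤ ∑ x ∈ Finset.Icc 1 N ×ˢ Finset.Icc 1 N, F x :=
        Finset.sum_le_sum_of_subset_of_nonneg himg fun x _ _ => hF0 x
    _ = (∑ k ∈ Finset.Icc 1 N, a (p ^ k) / (p : ℝ) ^ k) * ∑ n ∈ Finset.Icc 1 N, a n / n := by
        rw [Finset.sum_product, Finset.sum_mul]
        refine Finset.sum_congr rfl fun k _ => ?_
        rw [Finset.mul_sum]

/-- **Integers with a prime factor in a finite set of primes.** For `a ≥ 0` multiplicative on coprime
arguments and a finite set `S` of primes:
`Σ_{1≤m≤N, ∃p∈S, p∣m} a(m)/m ≤ (Σ_{p∈S}Σ_{1≤k≤N} a(p^k)/p^k)·(Σ_{1≤n≤N} a(n)/n)`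
(the indicator of a union is at most the sum of the indicators). [cite: HallTenenbaum1988, (0.4)] -/
theorem sum_div_filter_exists_dvd_le (ha0 : ∀ n, 0 ≤ a n)
    (hmul : ∀ m n, Nat.Coprime m n → a (m * n) = a m * a n) {S : Finset ℕ}
    (hS : ∀ p ∈ S, p.Prime) (N : ℕ) :
    ∑ m ∈ (Finset.Icc 1 N).filter (fun m => ∃ p ∈ S, p ∣ m), a m / m ≤
      (∑ p ∈ S, ∑ k ∈ Finset.Icc 1 N, a (p ^ k) / (p : ℝ) ^ k) * ∑ n ∈ Finset.Icc 1 N, a n / n := by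
  classical
  have hnn : ∀ m, 0 ≤ a m / m := fun m => div_nonneg (ha0 m) (Nat.cast_nonneg m)
  -- indicator of the union ≤ sum of indicators
  have h1 : ∑ m ∈ (Finset.Icc 1 N).filter (fun m => ∃ p ∈ S, p ∣ m), a m / m ≤
      ∑ p ∈ S, ∑ m ∈ (Finset.Icc 1 N).filter (fun m => p ∣ m), a m / m := by
    rw [Finset.sum_filter]
    simp_rw [Finset.sum_filter]
    rw [Finset.sum_comm]
    refine Finset.sum_le_sum fun m _ => ?_
    split_ifs with h
    · obtain ⟨p, hpS, hpm⟩ := h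
      calc a m / m = (if p ∣ m then a m / m else 0) := by rw [if_pos hpm]
        _ ≤ ∑ p ∈ S, if p ∣ m then a m / m else 0 :=
            Finset.single_le_sum (f := fun p => if p ∣ m then a m / m else 0)
              (fun q _ => by split_ifs <;> simp [hnn m]) hpS
    · exact Finset.sum_nonneg fun q _ => by split_ifs <;> simp [hnn m]
  refine h1.trans ?_
  rw [Finset.sum_mul]
  exact Finset.sum_le_sum fun p hp => sum_div_filter_dvd_le_mul ha0 hmul (hS p hp) N

/-- `Σ_{1≤k≤K} (k+1)x^k ≤ 6x` for `0 ≤ x ≤ 1/2` (`(k+1)x^k ≤ x·(k+1)2^{1−k}` and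
`Σ_{j≥0}(j+2)2^{−j} = 6`). [folklore, geometric series] [cite: HallTenenbaum1988, (0.4)] -/
theorem sum_succ_mul_pow_le {x : ℝ} (hx0 : 0 ≤ x) (hx : x ≤ 1 / 2) (K : ℕ) :
    ∑ k ∈ Finset.Icc 1 K, ((k : ℝ) + 1) * x ^ k ≤ 6 * x := by
  -- the full series `Σ_{j≥0} (j+2)(1/2)^j = 6`
  have hgeo : HasSum (fun j : ℕ => ((j : ℝ) + 2) * (1 / 2 : ℝ) ^ j) 6 := by
    have h1 : HasSum (fun j : ℕ => (j : ℝ) * (1 / 2 : ℝ) ^ j) ((1 / 2 : ℝ) / (1 - 1 / 2) ^ 2) :=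
      hasSum_coe_mul_geometric_of_norm_lt_one (by norm_num)
    have h2 : HasSum (fun j : ℕ => (2 : ℝ) * (1 / 2 : ℝ) ^ j) (2 * 2) := hasSum_geometric_two.mul_left 2
    convert h1.add h2 using 1
    · funext j; ring
    · norm_num
  -- termwise: `(k+1) x^k = x · ((k+1) x^{k-1}) ≤ x · (k+1) (1/2)^{k-1}`; reindex `j = k - 1`
  have hterm : ∀ k ∈ Finset.Icc 1 K,
      ((k : ℝ) + 1) * x ^ k ≤ x * ((((k - 1 : ℕ) : ℝ) + 2) * (1 / 2 : ℝ) ^ (k - 1)) := by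
    intro k hk
    have hk1 : 1 ≤ k := (Finset.mem_Icc.mp hk).1
    have hxk : x ^ k = x * x ^ (k - 1) := by
      rw [← pow_succ']; congr 1; omega
    have hcast : (((k - 1 : ℕ) : ℝ) + 2) = (k : ℝ) + 1 := by
      rw [Nat.cast_sub hk1]; push_cast; ring
    rw [hxk, hcast]
    have hpow : x ^ (k - 1) ≤ (1 / 2 : ℝ) ^ (k - 1) := pow_le_pow_left₀ hx0 hx _
    rw [show ((k : ℝ) + 1) * (x * x ^ (k - 1)) = (x * ((k : ℝ) + 1)) * x ^ (k - 1) by ring,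
      show x * (((k : ℝ) + 1) * (1 / 2 : ℝ) ^ (k - 1)) = (x * ((k : ℝ) + 1)) * (1 / 2 : ℝ) ^ (k - 1)
        by ring]
    exact mul_le_mul_of_nonneg_left hpow (by positivity)
  calc ∑ k ∈ Finset.Icc 1 K, ((k : ℝ) + 1) * x ^ k
      ≤ ∑ k ∈ Finset.Icc 1 K, x * ((((k - 1 : ℕ) : ℝ) + 2) * (1 / 2 : ℝ) ^ (k - 1)) :=
        Finset.sum_le_sum hterm
    _ = x * ∑ k ∈ Finset.Icc 1 K, (((k - 1 : ℕ) : ℝ) + 2) * (1 / 2 : ℝ) ^ (k - 1) := by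
        rw [Finset.mul_sum]
    _ = x * ∑ j ∈ Finset.range K, ((j : ℝ) + 2) * (1 / 2 : ℝ) ^ j := by
        congr 1
        refine Finset.sum_nbij' (fun k => k - 1) (fun j => j + 1) ?_ ?_ ?_ ?_ ?_
        · intro k hk
          have := Finset.mem_Icc.mp hk
          exact Finset.mem_range.mpr (by omega)
        · intro j hj
          have := Finset.mem_range.mp hj
          exact Finset.mem_Icc.mpr ⟨by omega, by omega⟩
        · intro k hk
          have := (Finset.mem_Icc.mp hk).1
          omega
        · intro j _
          omega
        · intro k _
          rfl
    _ ≤ x * 6 := by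
        refine mul_le_mul_of_nonneg_left ?_ hx0
        exact sum_le_hasSum _ (fun j _ => by positivity) hgeo
    _ = 6 * x := by ring

end Generic

/-! ## §2 The small prime factors: `(m, 𝔮) > 1`, `𝔮 = ∏_{q<D⁴} q` -/

/-- An integer not coprime to `𝔮 = ∏_{q<D⁴, q prime} q` has a prime factor `p < D⁴`
(§15 p. 31: "every `n` can be uniquely written as `n = n₁n₂` with `n₁ ∈ 𝔫(𝔮)`, `(n₂,𝔮) = 1`").
[cite: Zhang2022LandauSiegel, §15 p.31] -/
theorem exists_prime_lt_dvd_of_not_coprime_frakq {D m : ℕ} (h : ¬ Nat.Coprime m (frakq D)) :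
    ∃ p : ℕ, p.Prime ∧ p < D ^ 4 ∧ p ∣ m := by
  have hg : Nat.gcd m (frakq D) ≠ 1 := h
  set g := Nat.gcd m (frakq D) with hg_def
  have hp : g.minFac.Prime := Nat.minFac_prime hg
  refine ⟨g.minFac, hp, ?_, (Nat.minFac_dvd g).trans (Nat.gcd_dvd_left _ _)⟩
  have hdvd : g.minFac ∣ frakq D := (Nat.minFac_dvd g).trans (Nat.gcd_dvd_right _ _)
  rw [frakq] at hdvd
  obtain ⟨q, hq, hpq⟩ := (Prime.dvd_finsetProd_iff hp.prime _).mp hdvd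
  obtain ⟨hqr, hqp⟩ := Finset.mem_filter.mp hq
  rw [(Nat.prime_dvd_prime_iff_eq hp hqp).mp hpq]
  exact Finset.mem_range.mp hqr

/-- The primes below `D⁴` as a finite set of primes: membership in `(range (D⁴)).filter Prime`. [folklore] -/
private theorem prime_of_mem_filter {D p : ℕ} (hp : p ∈ (Finset.range (D ^ 4)).filter Nat.Prime) :
    p.Prime := (Finset.mem_filter.mp hp).2

/-! ## §3 The majorant `τ₂·|κ₂|`: prime powers, the full sum, and the small-prime-factor sum -/

section Kappa

variable (b : ℝ)

/-- `τ₂(p^k) = k + 1` (the divisors of `p^k` are `1, p, …, p^k`; Hardy–Wright Thm 273-type count,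
here read off Mathlib's `Nat.divisors_prime_pow`). [cite: HallTenenbaum1988, (0.4)] -/
theorem tau_two_prime_pow {p : ℕ} (hp : p.Prime) (k : ℕ) : tau 2 (p ^ k) = (k : ℝ) + 1 := by
  rw [tau_two_apply, Nat.divisors_prime_pow hp k, Finset.card_map, Finset.card_range]
  push_cast
  ring

/-- **The small factor at a small prime.** For a prime `p` and every `K`:
`Σ_{1≤k≤K} τ₂(p^k)|κ₂(p^k)|/p^k ≤ 6|b₁|(log p)/p` (`|κ₂(p^k)| ≤ |b₁| log p` for `k ≥ 1`,
`AppendixAKappa2PrimePowers.norm_kappa₂_prime_pow_succ_le`, and `Σ_{k≥1}(k+1)p^{−k} ≤ 6/p`).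
[cite: Zhang2022LandauSiegel, §17 u021 p.98] -/
theorem sum_tau_mul_norm_kappa₂_prime_pow_div_le {p : ℕ} (hp : p.Prime) (K : ℕ) :
    ∑ k ∈ Finset.Icc 1 K, tau 2 (p ^ k) * ‖kappa₂ b (p ^ k)‖ / (p : ℝ) ^ k ≤
      6 * |b| * Real.log p / p := by
  have hp0 : (0 : ℝ) < p := by exact_mod_cast hp.pos
  have hlog : 0 ≤ Real.log p := Real.log_nonneg (by exact_mod_cast hp.one_lt.le)
  have hterm : ∀ k ∈ Finset.Icc 1 K, tau 2 (p ^ k) * ‖kappa₂ b (p ^ k)‖ / (p : ℝ) ^ k ≤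
      |b| * Real.log p * (((k : ℝ) + 1) * ((p : ℝ)⁻¹) ^ k) := by
    intro k hk
    have hk1 : 1 ≤ k := (Finset.mem_Icc.mp hk).1
    obtain ⟨j, rfl⟩ : ∃ j, k = j + 1 := ⟨k - 1, by omega⟩
    rw [tau_two_prime_pow hp]
    have hκ := AppendixA.norm_kappa₂_prime_pow_succ_le b hp j
    rw [div_eq_mul_inv, ← inv_pow]
    have h3 : 0 ≤ ((p : ℝ)⁻¹) ^ (j + 1) := by positivity
    have h4 : 0 ≤ ((j + 1 : ℕ) : ℝ) + 1 := by positivity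
    calc (((j + 1 : ℕ) : ℝ) + 1) * ‖kappa₂ b (p ^ (j + 1))‖ * ((p : ℝ)⁻¹) ^ (j + 1)
        ≤ (((j + 1 : ℕ) : ℝ) + 1) * (|b| * Real.log p) * ((p : ℝ)⁻¹) ^ (j + 1) := by gcongr
      _ = |b| * Real.log p * ((((j + 1 : ℕ) : ℝ) + 1) * ((p : ℝ)⁻¹) ^ (j + 1)) := by ring
  have hx : ((p : ℝ)⁻¹) ≤ 1 / 2 := by
    rw [one_div]
    exact inv_anti₀ (by norm_num) (by exact_mod_cast hp.two_le)
  calc ∑ k ∈ Finset.Icc 1 K, tau 2 (p ^ k) * ‖kappa₂ b (p ^ k)‖ / (p : ℝ) ^ k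
      ≤ ∑ k ∈ Finset.Icc 1 K, |b| * Real.log p * (((k : ℝ) + 1) * ((p : ℝ)⁻¹) ^ k) :=
        Finset.sum_le_sum hterm
    _ = |b| * Real.log p * ∑ k ∈ Finset.Icc 1 K, ((k : ℝ) + 1) * ((p : ℝ)⁻¹) ^ k := by
        rw [Finset.mul_sum]
    _ ≤ |b| * Real.log p * (6 * (p : ℝ)⁻¹) := by
        refine mul_le_mul_of_nonneg_left (sum_succ_mul_pow_le (by positivity) hx K) (by positivity)
    _ = 6 * |b| * Real.log p / p := by rw [div_eq_mul_inv]; ring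

/-- **The full majorant sum.** `Σ_{1≤n≤N} τ₂(n)|κ₂(n)|/n ≤ majorantConst 0 2 · exp(2|b₁| log(4N))`
for `N ≥ 2`: Hall–Tenenbaum via the tree's `MeanSquareMajorant.sum_div_le` with `a = 0`, `K = 2|b₁|`
(`τ₂(p)|κ₂(p)| = 2|p^{−ib₁}−1| ≤ 2|b₁| log p`), `d = 2` (`τ₂(p^ν)|κ₂(p^ν)| ≤ (ν+1)²`). With `N ≤ P`
and `|b₁| ≍ α`, `2|b₁| log 4N ≍ 2π`: an absolute constant. [cite: HallTenenbaum1988, (0.4)] -/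
theorem sum_tau_mul_norm_kappa₂_div_le {N : ℕ} (hN : 2 ≤ N) :
    ∑ n ∈ Finset.Icc 1 N, tau 2 n * ‖kappa₂ b n‖ / n ≤
      majorantConst 0 2 * Real.exp (2 * |b| * Real.log (4 * N)) := by
  have hmulτ := isMultiplicative_tau 2
  have hmulκ := isMultiplicative_kappa₂ b
  have h := sum_div_le (f := fun n => tau 2 n * ‖kappa₂ b n‖) (a := 0) (d := 2) (K := 2 * |b|)
    (by simp [hmulτ.map_one, hmulκ.map_one])
    (fun m n hmn => by
      show tau 2 (m * n) * ‖kappa₂ b (m * n)‖ = tau 2 m * ‖kappa₂ b m‖ * (tau 2 n * ‖kappa₂ b n‖)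
      rw [hmulτ.map_mul_of_coprime hmn, hmulκ.map_mul_of_coprime hmn, norm_mul]; ring)
    (fun n => mul_nonneg (tau_nonneg 2 n) (norm_nonneg _)) (by positivity)
    (fun p hp => by
      show tau 2 p * ‖kappa₂ b p‖ ≤ ((0 : ℕ) : ℝ) + 2 * |b| * Real.log p
      rw [tau_prime 2 hp, Nat.cast_zero, zero_add]
      have := norm_kappa₂_prime_le b hp
      push_cast
      nlinarith [norm_nonneg (kappa₂ b p)])
    (fun p ν hp => by
      show tau 2 (p ^ ν) * ‖kappa₂ b (p ^ ν)‖ ≤ ((ν : ℝ) + 1) ^ 2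
      have h2 := norm_kappa₂_prime_pow_le b hp ν
      rw [pow_one] at h2
      rw [tau_two_prime_pow hp ν, sq]
      exact mul_le_mul_of_nonneg_left h2 (by positivity))
    hN
  simpa [pow_zero, mul_one, mul_assoc] using h

/-- **THE SMALL-PRIME-FACTOR SUM** (the `(m₁,𝔮) > 1` mechanism of §17.u021): for `N ≥ 2`,
`Σ_{1≤m≤N, (m,𝔮)>1} τ₂(m)|κ₂(m)|/m ≤ 6|b₁|(log D⁴ + log 4)·majorantConst 0 2·exp(2|b₁| log(4N))`
— every such `m` has a prime factor `p < D⁴`; multiples of `p` cost `6|b₁|(log p)/p` times the full sum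
(`sum_div_filter_exists_dvd_le`, `sum_tau_mul_norm_kappa₂_prime_pow_div_le`); Mertens
`Σ_{p<D⁴} log p/p ≤ log D⁴ + log 4` (`MertensBound.sum_log_div_prime_le`). With `|b₁| ≍ 𝓛⁻⁹`, `N ≤ P`:
`≍ 𝓛⁻⁸`. [cite: Zhang2022LandauSiegel, §17 u021 p.98] -/
theorem sum_not_coprime_frakq_tau_mul_norm_kappa₂_div_le (D : ℕ) {N : ℕ} (hN : 2 ≤ N) :
    ∑ m ∈ (Finset.Icc 1 N).filter (fun m => ¬ Nat.Coprime m (frakq D)),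
        tau 2 m * ‖kappa₂ b m‖ / m ≤
      6 * |b| * (Real.log ((D : ℝ) ^ 4) + Real.log 4) *
        (majorantConst 0 2 * Real.exp (2 * |b| * Real.log (4 * N))) := by
  classical
  set S := (Finset.range (D ^ 4)).filter Nat.Prime with hS
  have ha0 : ∀ n, 0 ≤ tau 2 n * ‖kappa₂ b n‖ := fun n => mul_nonneg (tau_nonneg 2 n) (norm_nonneg _)
  have hmulτ := isMultiplicative_tau 2
  have hmulκ := isMultiplicative_kappa₂ b
  have hmul : ∀ m n, Nat.Coprime m n →
      tau 2 (m * n) * ‖kappa₂ b (m * n)‖ = tau 2 m * ‖kappa₂ b m‖ * (tau 2 n * ‖kappa₂ b n‖) := by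
    intro m n hmn
    rw [hmulτ.map_mul_of_coprime hmn, hmulκ.map_mul_of_coprime hmn, norm_mul]; ring
  -- (m, 𝔮) > 1 ⇒ ∃ p ∈ S, p ∣ m: the filtered sum is dominated by the `∃`-filtered sum
  have hsub : (Finset.Icc 1 N).filter (fun m => ¬ Nat.Coprime m (frakq D)) ⊆
      (Finset.Icc 1 N).filter (fun m => ∃ p ∈ S, p ∣ m) := by
    intro m hm
    obtain ⟨hmI, hmq⟩ := Finset.mem_filter.mp hm
    obtain ⟨p, hp, hpD, hpm⟩ := exists_prime_lt_dvd_of_not_coprime_frakq hmq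
    exact Finset.mem_filter.mpr ⟨hmI, p, Finset.mem_filter.mpr ⟨Finset.mem_range.mpr hpD, hp⟩, hpm⟩
  have h1 := Finset.sum_le_sum_of_subset_of_nonneg hsub
    (f := fun m => tau 2 m * ‖kappa₂ b m‖ / m) fun m _ _ => div_nonneg (ha0 m) (Nat.cast_nonneg m)
  have h2 := sum_div_filter_exists_dvd_le ha0 hmul (S := S) (fun p hp => prime_of_mem_filter hp) N
  -- the prime sum `Σ_{p∈S} Σ_k ≤ 6|b| Σ_{p∈S} log p/p ≤ 6|b|(log D⁴ + log 4)`
  have h3 : ∑ p ∈ S, ∑ k ∈ Finset.Icc 1 N, tau 2 (p ^ k) * ‖kappa₂ b (p ^ k)‖ / (p : ℝ) ^ k ≤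
      6 * |b| * (Real.log ((D : ℝ) ^ 4) + Real.log 4) := by
    calc ∑ p ∈ S, ∑ k ∈ Finset.Icc 1 N, tau 2 (p ^ k) * ‖kappa₂ b (p ^ k)‖ / (p : ℝ) ^ k
        ≤ ∑ p ∈ S, 6 * |b| * Real.log p / p :=
          Finset.sum_le_sum fun p hp => sum_tau_mul_norm_kappa₂_prime_pow_div_le b (prime_of_mem_filter hp) N
      _ = 6 * |b| * ∑ p ∈ S, Real.log p / p := by
          rw [Finset.mul_sum]
          refine Finset.sum_congr rfl fun p _ => ?_
          ring
      _ ≤ 6 * |b| * (Real.log ((D : ℝ) ^ 4) + Real.log 4) := by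
          refine mul_le_mul_of_nonneg_left ?_ (by positivity)
          have hSsub : S ⊆ Nat.primesLE (D ^ 4) := by
            intro p hp
            obtain ⟨hpr, hpp⟩ := Finset.mem_filter.mp hp
            rw [Nat.primesLE_eq_filter_range]
            exact Finset.mem_filter.mpr ⟨Finset.mem_range.mpr (by have := Finset.mem_range.mp hpr; omega), hpp⟩
          calc ∑ p ∈ S, Real.log p / p ≤ ∑ p ∈ Nat.primesLE (D ^ 4), Real.log p / p :=
                Finset.sum_le_sum_of_subset_of_nonneg hSsub fun p hp _ =>
                  div_nonneg (Real.log_natCast_nonneg p) (Nat.cast_nonneg p)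
            _ ≤ Real.log ((D ^ 4 : ℕ) : ℝ) + Real.log 4 := MertensBound.sum_log_div_prime_le (D ^ 4)
            _ = Real.log ((D : ℝ) ^ 4) + Real.log 4 := by push_cast; ring
  have h4 := sum_tau_mul_norm_kappa₂_div_le b hN
  have hpos : 0 ≤ ∑ n ∈ Finset.Icc 1 N, tau 2 n * ‖kappa₂ b n‖ / n :=
    Finset.sum_nonneg fun n _ => div_nonneg (ha0 n) (Nat.cast_nonneg n)
  have hlogD : 0 ≤ Real.log ((D : ℝ) ^ 4) := by
    rw [show ((D : ℝ) ^ 4) = ((D ^ 4 : ℕ) : ℝ) by push_cast; ring]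
    exact Real.log_natCast_nonneg _
  have hlog4 : 0 ≤ Real.log 4 := Real.log_nonneg (by norm_num)
  have hcoef : 0 ≤ 6 * |b| * (Real.log ((D : ℝ) ^ 4) + Real.log 4) :=
    mul_nonneg (by positivity) (add_nonneg hlogD hlog4)
  calc _ ≤ _ := h1
    _ ≤ _ := h2
    _ ≤ 6 * |b| * (Real.log ((D : ℝ) ^ 4) + Real.log 4) *
          ∑ n ∈ Finset.Icc 1 N, tau 2 n * ‖kappa₂ b n‖ / n :=
        mul_le_mul_of_nonneg_right h3 hpos
    _ ≤ _ := mul_le_mul_of_nonneg_left h4 hcoef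

/-- **Multiples of one small prime** (the `p₀ ∣ m₁` case of the §17.u021 remainder `R₁`, asked by
zl-libC-p7): for a prime `p` and `N ≥ 2`,
`Σ_{1≤m≤N, p∣m} τ₂(m)|κ₂(m)|/m ≤ (6|b₁|(log p)/p) · majorantConst 0 2 · exp(2|b₁| log(4N))`
(`sum_div_filter_dvd_le_mul` + `sum_tau_mul_norm_kappa₂_prime_pow_div_le` + `sum_tau_mul_norm_kappa₂_div_le`).
With `|b₁| ≍ 𝓛⁻⁹`, `N ≤ P`: `≍ 𝓛⁻⁹(log p)/p`, summable against a further `1/p`.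
[cite: Zhang2022LandauSiegel, §17 u021 p.98] -/
theorem sum_filter_dvd_tau_mul_norm_kappa₂_div_le {p : ℕ} (hp : p.Prime) {N : ℕ} (hN : 2 ≤ N) :
    ∑ m ∈ (Finset.Icc 1 N).filter (fun m => p ∣ m), tau 2 m * ‖kappa₂ b m‖ / m ≤
      6 * |b| * Real.log p / p * (majorantConst 0 2 * Real.exp (2 * |b| * Real.log (4 * N))) := by
  have ha0 : ∀ n, 0 ≤ tau 2 n * ‖kappa₂ b n‖ := fun n => mul_nonneg (tau_nonneg 2 n) (norm_nonneg _)
  have hmulτ := isMultiplicative_tau 2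
  have hmulκ := isMultiplicative_kappa₂ b
  have hmul : ∀ m n, Nat.Coprime m n →
      tau 2 (m * n) * ‖kappa₂ b (m * n)‖ = tau 2 m * ‖kappa₂ b m‖ * (tau 2 n * ‖kappa₂ b n‖) := by
    intro m n hmn
    rw [hmulτ.map_mul_of_coprime hmn, hmulκ.map_mul_of_coprime hmn, norm_mul]; ring
  have h1 := sum_div_filter_dvd_le_mul ha0 hmul hp N
  have h2 := sum_tau_mul_norm_kappa₂_prime_pow_div_le b hp N
  have h3 := sum_tau_mul_norm_kappa₂_div_le b hN
  have hpos : 0 ≤ ∑ n ∈ Finset.Icc 1 N, tau 2 n * ‖kappa₂ b n‖ / n :=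
    Finset.sum_nonneg fun n _ => div_nonneg (ha0 n) (Nat.cast_nonneg n)
  have hcoef : 0 ≤ 6 * |b| * Real.log p / p :=
    div_nonneg (mul_nonneg (by positivity) (Real.log_natCast_nonneg p)) (Nat.cast_nonneg p)
  calc _ ≤ _ := h1
    _ ≤ 6 * |b| * Real.log p / p * ∑ n ∈ Finset.Icc 1 N, tau 2 n * ‖kappa₂ b n‖ / n :=
        mul_le_mul_of_nonneg_right h2 hpos
    _ ≤ _ := mul_le_mul_of_nonneg_left h3 hcoef

end Kappa

end Literature.NumberTheory.LFunctions.Zhang2022.MeanSquareMajorant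

end
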